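/-
Copyright: the b2b-balaban T⁴-continuum CRUX team, row NE7b leaf lineage `t4-ne7b-formalise-leaf-06` (gen 151). Project licence.
-/
import Summits.QuantumFields.BalabanUV.T4Continuum.Spine.NE7b.HessianFormFirstOrder
import Mathlib.Analysis.Calculus.MeanValue

/-!
# THE WINDOW HESSIAN FROM A THIRD-DERIVATIVE BOUND, FOR AN EXPONENT `C³` ONLY ON AN OPEN SET CONTAINING THE WINDOW: `‖D³Φ‖ ≤ c₃`
# ON a convex `K ⊆ U` makes `D²Φ` `c₃`-Lipschitz ON `K`, so a Hessian floor AT ONE POINT `x₀ ∈ K` is a floor ON `K` up to `c₃·ρ`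
# (`ρ` = the window's radius about `x₀`), and the road's first-order letter ON `K` follows with modulus `2σ − c₃ρ` — the `ContDiffOn`
# companion of `…ConvexWindowSuppliers` §3, the socket the analytic letters (`…AnalyticHessianLetter`, `…AnalyticThirdDerivLetter`) can
# actually meet (row NE7b, node U5c; letter (ℓ1) of the windowed road; [folklore])

Cell `pub-balaban`, sub-cell `t4`, spine estimate NE7b (`T4WeightBudget.RelWeightBound`; the cell's OWN estimate — NOT PRINTED in
[Bałaban 1983–89], NOT PROVED).  Crux-route work under `Spine/NE7b/` by a row leaf on the convexity road; NOTHING of Bałaban's is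
named, valued or asserted; no `T4Continuum/Support` leaf typed; no `def`; zero `sorry`.  Imports: leaf-03's `…HessianFormFirstOrder`
(§5, the `ContDiffOn` first-order engine, BY NAME) and Mathlib's mean value inequality.

WHY.  The OWNER's `…ConvexWindowSuppliers` §3 («the window is small, so the anharmonic Hessian is small»: `‖D³P‖ ≤ c₃` on
`K ⊆ B̄(0, ρ)` ⟹ `‖D²P(x)‖ ≤ ‖D²P(0)‖ + c₃ρ` ⟹ modulus `2σ − c₃ρ` ON `K`) asks `ContDiff ℝ 3 P` on the WHOLE space and centres the
window at `0`.  The suppliers of `c₃` in print's currency — real parts of functionals ANALYTIC ON A COMPLEX NEIGHBOURHOOD of the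
window (`…AnalyticThirdDerivLetter.thirdDerivOn_chart_norm_le`: `c₃ = 27M∕δ³`) — deliver `ContDiffOn` on the real preimage of that
neighbourhood and nothing globally (located INFO ι-leaf06-g150-1, refuter R-AHL-g83-1: «the sockets' global `C²`∕`C³` display is
unmeetable by functionals analytic only near the window»).  leaf-03's `…HessianFormFirstOrder` §5 already runs the first-order engine
from `ContDiffOn ℝ 2 Φ U`; THIS FILE types the missing middle link ON `U`: third-derivative bound on `K` ⟹ Lipschitz Hessian on `K` ⟹
Hessian floor ∕ ceiling on `K` from the Hessian AT ANY ONE POINT `x₀ ∈ K` ⟹ (§5 BY NAME) the first-order letter on `K`.  So the chain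
«print's `(M, δ)` ⟹ `c₃` ⟹ `λ = 2σ − c₃ρ` ON the window ⟹ the road's letter» closes with every regularity hypothesis ON `U` only.

WHAT IS PROVED ([folklore]; `E` a real normed space, `U ⊆ E` open, `K ⊆ U` convex, `Φ : E → F` resp. `E → ℝ` with `ContDiffOn ℝ 3 Φ U`,
`hP3 : ∀ x ∈ K, ‖iteratedFDeriv ℝ 3 Φ x‖ ≤ c₃` — the global `iteratedFDeriv` AT points of the open `U`, which is where it is meaningful):
* §1 **`norm_hessian_sub_le_of_thirdDerivOn`** — `∀ x y ∈ K, ‖D²Φ(y) − D²Φ(x)‖ ≤ c₃‖y − x‖` (Mathlib's mean value inequality on the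
  convex `K` for `D²Φ`, differentiable at the points of `U` by `ContDiffAt.differentiableAt_iteratedFDeriv`, `‖D(D²Φ)‖ = ‖D³Φ‖`).
* §2 ABOUT A CENTRE `x₀ ∈ K` with `K ⊆ closedBall x₀ ρ`: `norm_hessian_le_of_thirdDerivOn` (`‖D²Φ(x)‖ ≤ ‖D²Φ(x₀)‖ + c₃ρ` — the OWNER's
  shape, any centre, ON `U`), **`hessianOn_lower_of_thirdDerivOn`** (`D²Φ(x₀)[v,v] − c₃ρ‖v‖² ≤ D²Φ(x)[v,v]` — the centre's form is KEPT,
  not replaced by its norm), `hessianOn_upper_of_thirdDerivOn`, and with a floor AT THE CENTRE `2σ‖v‖² ≤ D²Φ(x₀)[v,v]`: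
  **`hessianOn_floor_of_thirdDerivOn`** (`(2σ − c₃ρ)‖v‖² ≤ D²Φ(x)[v,v]` on `K`).
* §3 THE END, leaf-03's §5 BY NAME: **`firstOrderOn_of_thirdDerivOn`** (`fderiv` currency: `Φ x + DΦ(x)(y − x) + (σ − c₃ρ∕2)‖y − x‖² ≤ Φ y`
  for `x, y ∈ K`) and `firstOrderOn_of_thirdDerivOn_gradient` (complete inner-product space, `⟪∇Φ x, y − x⟫`).

NOT HERE (honest): the numbers `σ` (floor at the expansion point), `c₃`, `ρ` for Bałaban's steps and the identification of `Φ` — (A3) ∕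
(A1c), NC-NE7b-α UNRULED; no toy (the hypotheses are `…ConvexWindowSuppliers` §3's, restricted to `U`); the analytic supply of `c₃` itself (the sibling `…AnalyticThirdDerivLetter`, not imported here: no olean yet —
the junction is one `exact`); anisotropic ∕ cell-local third-derivative readings (`…ConvexWindowSuppliersBox∕Local∕Cells`, global `C³`
there); anything of Bałaban's.  BY-NAME EFFECT ON THE WALL: NONE (a socket-side companion).  NE7b NOT PRINTED ∕ NOT PROVED; spine PROVED
0∕9; rung (B)+1 on a FINITE torus — NOT infinite volume, NOT the mass gap, NOT Clay.
HONEST DEPENDENCY: continuum YM on T⁴ ⇐ BetaPertH ∧ nine spine estimates (0/9 proved); BetaPertH ⇐ (D1) ∧ (D4) ∧ CAP+tail.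
-/

set_option autoImplicit false

open Set Metric
open scoped RealInnerProductSpace Gradient
open Summit.QuantumFields.BalabanUV.T4Continuum.NE7b.HessianFormFirstOrder

namespace Summit.QuantumFields.BalabanUV.T4Continuum.NE7b.WindowHessianFromThirdDeriv

/-! ## §1 `‖D³Φ‖ ≤ c₃` ON a convex window inside the smoothness domain ⟹ `D²Φ` is `c₃`-Lipschitz ON the window -/

section Lipschitz

variable {E : Type*} [NormedAddCommGroup E] [NormedSpace ℝ E] {F : Type*} [NormedAddCommGroup F] [NormedSpace ℝ F]

/-- **LIPSCHITZ HESSIAN ON THE WINDOW**: `U` open, `K ⊆ U` convex, `Φ ∈ C³(U)`, `‖D³Φ(x)‖ ≤ c₃` for `x ∈ K` ⟹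
`‖D²Φ(y) − D²Φ(x)‖ ≤ c₃‖y − x‖` for `x, y ∈ K`. [folklore] -/
theorem norm_hessian_sub_le_of_thirdDerivOn {Φ : E → F} {U K : Set E} {c₃ : ℝ} (hU : IsOpen U) (hKU : K ⊆ U) (hK : Convex ℝ K)
    (hΦ : ContDiffOn ℝ 3 Φ U) (hP3 : ∀ x ∈ K, ‖iteratedFDeriv ℝ 3 Φ x‖ ≤ c₃) {x y : E} (hx : x ∈ K) (hy : y ∈ K) :
    ‖iteratedFDeriv ℝ 2 Φ y - iteratedFDeriv ℝ 2 Φ x‖ ≤ c₃ * ‖y - x‖ := by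
  have hd : ∀ z ∈ K, DifferentiableAt ℝ (iteratedFDeriv ℝ 2 Φ) z := fun z hz =>
    (hΦ.contDiffAt (hU.mem_nhds (hKU hz))).differentiableAt_iteratedFDeriv (by norm_num)
  have hb : ∀ z ∈ K, ‖fderiv ℝ (iteratedFDeriv ℝ 2 Φ) z‖ ≤ c₃ := fun z hz => by
    rw [norm_fderiv_iteratedFDeriv]; exact hP3 z hz
  exact hK.norm_image_sub_le_of_norm_fderiv_le hd hb hx hy

end Lipschitz

/-! ## §2 About a centre `x₀ ∈ K`, `K ⊆ closedBall x₀ ρ`: the Hessian ON the window from the Hessian AT the centre -/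

section Centre

variable {E : Type*} [NormedAddCommGroup E] [NormedSpace ℝ E] {F : Type*} [NormedAddCommGroup F] [NormedSpace ℝ F]

/-- **THE OWNER's SHAPE, ON `U`, ANY CENTRE**: `‖D²Φ(x)‖ ≤ ‖D²Φ(x₀)‖ + c₃ρ` for `x ∈ K` (`x₀ ∈ K ⊆ closedBall x₀ ρ`). [folklore] -/
theorem norm_hessian_le_of_thirdDerivOn {Φ : E → F} {U K : Set E} {c₃ ρ : ℝ} {x₀ : E} (hU : IsOpen U) (hKU : K ⊆ U)
    (hK : Convex ℝ K) (h0 : x₀ ∈ K) (hKρ : K ⊆ closedBall x₀ ρ) (hΦ : ContDiffOn ℝ 3 Φ U)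
    (hP3 : ∀ x ∈ K, ‖iteratedFDeriv ℝ 3 Φ x‖ ≤ c₃) {x : E} (hx : x ∈ K) :
    ‖iteratedFDeriv ℝ 2 Φ x‖ ≤ ‖iteratedFDeriv ℝ 2 Φ x₀‖ + c₃ * ρ := by
  have hmv := norm_hessian_sub_le_of_thirdDerivOn hU hKU hK hΦ hP3 h0 hx
  have hxρ : ‖x - x₀‖ ≤ ρ := by rw [← dist_eq_norm]; exact hKρ hx
  have hc₃ : 0 ≤ c₃ := (norm_nonneg _).trans (hP3 x₀ h0)
  calc ‖iteratedFDeriv ℝ 2 Φ x‖ = ‖iteratedFDeriv ℝ 2 Φ x₀ + (iteratedFDeriv ℝ 2 Φ x - iteratedFDeriv ℝ 2 Φ x₀)‖ := by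
        rw [add_sub_cancel]
    _ ≤ ‖iteratedFDeriv ℝ 2 Φ x₀‖ + ‖iteratedFDeriv ℝ 2 Φ x - iteratedFDeriv ℝ 2 Φ x₀‖ := norm_add_le _ _
    _ ≤ ‖iteratedFDeriv ℝ 2 Φ x₀‖ + c₃ * ρ := by
        refine add_le_add le_rfl (hmv.trans ?_)
        exact mul_le_mul_of_nonneg_left hxρ hc₃

/-- The diagonal entries move by at most `c₃ρ‖v‖²` across the window: `|D²Φ(x)[v,v] − D²Φ(x₀)[v,v]| ≤ c₃ρ‖v‖²`. [folklore] -/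
theorem abs_hessian_sub_le_of_thirdDerivOn {Φ : E → ℝ} {U K : Set E} {c₃ ρ : ℝ} {x₀ : E} (hU : IsOpen U) (hKU : K ⊆ U)
    (hK : Convex ℝ K) (h0 : x₀ ∈ K) (hKρ : K ⊆ closedBall x₀ ρ) (hΦ : ContDiffOn ℝ 3 Φ U)
    (hP3 : ∀ x ∈ K, ‖iteratedFDeriv ℝ 3 Φ x‖ ≤ c₃) {x : E} (hx : x ∈ K) (v : E) :
    |iteratedFDeriv ℝ 2 Φ x ![v, v] - iteratedFDeriv ℝ 2 Φ x₀ ![v, v]| ≤ c₃ * ρ * ‖v‖ ^ 2 := by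
  have hmv := norm_hessian_sub_le_of_thirdDerivOn hU hKU hK hΦ hP3 h0 hx
  have hxρ : ‖x - x₀‖ ≤ ρ := by rw [← dist_eq_norm]; exact hKρ hx
  have hc₃ : 0 ≤ c₃ := (norm_nonneg _).trans (hP3 x₀ h0)
  have hD : ‖iteratedFDeriv ℝ 2 Φ x - iteratedFDeriv ℝ 2 Φ x₀‖ ≤ c₃ * ρ := hmv.trans (mul_le_mul_of_nonneg_left hxρ hc₃)
  have hop := (iteratedFDeriv ℝ 2 Φ x - iteratedFDeriv ℝ 2 Φ x₀).le_opNorm ![v, v]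
  simp only [Fin.prod_univ_two, Matrix.cons_val_zero, Matrix.cons_val_one, Real.norm_eq_abs,
    _root_.sub_apply] at hop
  calc |iteratedFDeriv ℝ 2 Φ x ![v, v] - iteratedFDeriv ℝ 2 Φ x₀ ![v, v]|
        ≤ ‖iteratedFDeriv ℝ 2 Φ x - iteratedFDeriv ℝ 2 Φ x₀‖ * (‖v‖ * ‖v‖) := hop
    _ ≤ c₃ * ρ * (‖v‖ * ‖v‖) := mul_le_mul_of_nonneg_right hD (by positivity)
    _ = c₃ * ρ * ‖v‖ ^ 2 := by ring

/-- **HESSIAN LOWER DISPLAY ON THE WINDOW FROM THE CENTRE** (the centre's form is KEPT): `D²Φ(x₀)[v,v] − c₃ρ‖v‖² ≤ D²Φ(x)[v,v]` for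
`x ∈ K`. [folklore] -/
theorem hessianOn_lower_of_thirdDerivOn {Φ : E → ℝ} {U K : Set E} {c₃ ρ : ℝ} {x₀ : E} (hU : IsOpen U) (hKU : K ⊆ U)
    (hK : Convex ℝ K) (h0 : x₀ ∈ K) (hKρ : K ⊆ closedBall x₀ ρ) (hΦ : ContDiffOn ℝ 3 Φ U)
    (hP3 : ∀ x ∈ K, ‖iteratedFDeriv ℝ 3 Φ x‖ ≤ c₃) :
    ∀ x ∈ K, ∀ v : E, iteratedFDeriv ℝ 2 Φ x₀ ![v, v] - c₃ * ρ * ‖v‖ ^ 2 ≤ iteratedFDeriv ℝ 2 Φ x ![v, v] := by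
  intro x hx v
  have h := (abs_le.1 (abs_hessian_sub_le_of_thirdDerivOn hU hKU hK h0 hKρ hΦ hP3 hx v)).1
  linarith

/-- **HESSIAN UPPER DISPLAY ON THE WINDOW FROM THE CENTRE**: `D²Φ(x)[v,v] ≤ D²Φ(x₀)[v,v] + c₃ρ‖v‖²` for `x ∈ K`. [folklore] -/
theorem hessianOn_upper_of_thirdDerivOn {Φ : E → ℝ} {U K : Set E} {c₃ ρ : ℝ} {x₀ : E} (hU : IsOpen U) (hKU : K ⊆ U)
    (hK : Convex ℝ K) (h0 : x₀ ∈ K) (hKρ : K ⊆ closedBall x₀ ρ) (hΦ : ContDiffOn ℝ 3 Φ U)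
    (hP3 : ∀ x ∈ K, ‖iteratedFDeriv ℝ 3 Φ x‖ ≤ c₃) :
    ∀ x ∈ K, ∀ v : E, iteratedFDeriv ℝ 2 Φ x ![v, v] ≤ iteratedFDeriv ℝ 2 Φ x₀ ![v, v] + c₃ * ρ * ‖v‖ ^ 2 := by
  intro x hx v
  have h := (abs_le.1 (abs_hessian_sub_le_of_thirdDerivOn hU hKU hK h0 hKρ hΦ hP3 hx v)).2
  linarith

/-- **A FLOOR AT THE CENTRE IS A FLOOR ON THE WINDOW, UP TO `c₃ρ`**: `2σ‖v‖² ≤ D²Φ(x₀)[v,v]` for all `v` ⟹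
`(2σ − c₃ρ)‖v‖² ≤ D²Φ(x)[v,v]` for `x ∈ K` — in the road's `2·Q(v) ≤ D²Φ(x)[v,v]` shape with `Q(v) = (σ − c₃ρ∕2)‖v‖²`. [folklore] -/
theorem hessianOn_floor_of_thirdDerivOn {Φ : E → ℝ} {U K : Set E} {c₃ ρ σ : ℝ} {x₀ : E} (hU : IsOpen U) (hKU : K ⊆ U)
    (hK : Convex ℝ K) (h0 : x₀ ∈ K) (hKρ : K ⊆ closedBall x₀ ρ) (hΦ : ContDiffOn ℝ 3 Φ U)
    (hP3 : ∀ x ∈ K, ‖iteratedFDeriv ℝ 3 Φ x‖ ≤ c₃) (hσ : ∀ v : E, 2 * σ * ‖v‖ ^ 2 ≤ iteratedFDeriv ℝ 2 Φ x₀ ![v, v]) :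
    ∀ x ∈ K, ∀ v : E, 2 * ((σ - c₃ * ρ / 2) * ‖v‖ ^ 2) ≤ iteratedFDeriv ℝ 2 Φ x ![v, v] := by
  intro x hx v
  have h := hessianOn_lower_of_thirdDerivOn hU hKU hK h0 hKρ hΦ hP3 x hx v
  nlinarith [hσ v]

end Centre

/-! ## §3 THE END: the road's first-order letter ON the window, leaf-03's `ContDiffOn` engine BY NAME -/

section End

variable {E : Type*} [NormedAddCommGroup E] [NormedSpace ℝ E]

/-- **THE FIRST-ORDER LETTER ON THE WINDOW FROM `(σ, c₃, ρ)`, EVERYTHING ON `U`** (`fderiv` currency): `U` open, `K ⊆ U` convex,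
`x₀ ∈ K ⊆ closedBall x₀ ρ`, `Φ ∈ C³(U)`, `‖D³Φ‖ ≤ c₃` on `K`, `2σ‖v‖² ≤ D²Φ(x₀)[v,v]` ⟹ for all `x, y ∈ K`,
`Φ x + DΦ(x)(y − x) + (σ − c₃ρ∕2)‖y − x‖² ≤ Φ y` — modulus `λ = 2σ − c₃ρ` ON the window. [folklore] -/
theorem firstOrderOn_of_thirdDerivOn {Φ : E → ℝ} {U K : Set E} {c₃ ρ σ : ℝ} {x₀ : E} (hU : IsOpen U) (hKU : K ⊆ U)
    (hK : Convex ℝ K) (h0 : x₀ ∈ K) (hKρ : K ⊆ closedBall x₀ ρ) (hΦ : ContDiffOn ℝ 3 Φ U)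
    (hP3 : ∀ x ∈ K, ‖iteratedFDeriv ℝ 3 Φ x‖ ≤ c₃) (hσ : ∀ v : E, 2 * σ * ‖v‖ ^ 2 ≤ iteratedFDeriv ℝ 2 Φ x₀ ![v, v]) :
    ∀ x ∈ K, ∀ y ∈ K, Φ x + fderiv ℝ Φ x (y - x) + (σ - c₃ * ρ / 2) * ‖y - x‖ ^ 2 ≤ Φ y :=
  firstOrderOn_form_of_hessianOn_lower_fderiv_of_contDiffOn hU hKU hK (hΦ.of_le (by norm_num))
    (fun v => (σ - c₃ * ρ / 2) * ‖v‖ ^ 2) (hessianOn_floor_of_thirdDerivOn hU hKU hK h0 hKρ hΦ hP3 hσ)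

/-- The same in gradient currency (complete real inner-product space): `Φ x + ⟪∇Φ x, y − x⟫ + (σ − c₃ρ∕2)‖y − x‖² ≤ Φ y` on `K`.
[folklore] -/
theorem firstOrderOn_of_thirdDerivOn_gradient {H : Type*} [NormedAddCommGroup H] [InnerProductSpace ℝ H] [CompleteSpace H]
    {Φ : H → ℝ} {U K : Set H} {c₃ ρ σ : ℝ} {x₀ : H} (hU : IsOpen U) (hKU : K ⊆ U) (hK : Convex ℝ K) (h0 : x₀ ∈ K)
    (hKρ : K ⊆ closedBall x₀ ρ) (hΦ : ContDiffOn ℝ 3 Φ U) (hP3 : ∀ x ∈ K, ‖iteratedFDeriv ℝ 3 Φ x‖ ≤ c₃)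
    (hσ : ∀ v : H, 2 * σ * ‖v‖ ^ 2 ≤ iteratedFDeriv ℝ 2 Φ x₀ ![v, v]) :
    ∀ x ∈ K, ∀ y ∈ K, Φ x + ⟪gradient Φ x, y - x⟫ + (σ - c₃ * ρ / 2) * ‖y - x‖ ^ 2 ≤ Φ y :=
  firstOrderOn_form_of_hessianOn_lower_of_contDiffOn hU hKU hK (hΦ.of_le (by norm_num))
    (fun v => (σ - c₃ * ρ / 2) * ‖v‖ ^ 2) (hessianOn_floor_of_thirdDerivOn hU hKU hK h0 hKρ hΦ hP3 hσ)

end End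

end Summit.QuantumFields.BalabanUV.T4Continuum.NE7b.WindowHessianFromThirdDeriv
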